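import Literature.NumberTheory.PAdicHodge.LubinTateAinfTorsionLift
import Literature.NumberTheory.PAdicHodge.EisensteinCoeffLubinTate
import HarnessLib

/-!
# The Lubin–Tate action on Fontaine's element: `[a]_f(x_t) = x_{[a]t}`, `σ x_t = [χ(σ)]_f(x_t)`

Topic `Literature/NumberTheory/PAdicHodge`; THEOREMS ONLY; sequel of `LubinTateAinfTorsionLift` (Fontaine's element
`x_t ∈ A_inf(𝒪_D)` of a division tower `t = (tₙ)`, `P(t_{n+1}) = tₙ`, of `P = c·X + X^q` over the discrete Eisenstein
coefficient ring `CoeffDisc D`), of `EisensteinCoeffLubinTate` (`IsLTRing` for `CoeffDisc D`) and of the tree's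
Lubin–Tate points `GaloisRepresentations.LubinTatePoints` (`ltSMul M hA hf a x = [a]_f(x)` on a nil ideal `M`).

When `(CoeffDisc D, c, q)` satisfies the Lubin–Tate hypotheses (`hA : IsLTRing c q`; e.g. `c = ϖ_D`, `q = p^r`,
`isLTRing_coeffDisc`) and `q ≥ 2`, `f = P = cX + X^q` is a Lubin–Tate series (`isLTSeries_ltSeries`), so the
endomorphisms `[a]_f ∈ 𝒪_D⟦X⟧` act on the points `𝔫_𝒪 ⊂ A_inf(𝒪_D)` and `𝔪_{ℂ_F}`:
* §1 `[c]_f = P` on points (`ltSMul_self_eq_ltStep(C)`), `[a]_f ∘ P = P ∘ [a]_f` (`ltSMul_ltStep(C)`), `θ_𝒪 ∘ [a]_f =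
  [a]_f ∘ θ_𝒪` (`theta_ltSMul`), `σ ∘ [a]_f = [a]_f ∘ σ` (`gal_ltSMul`), congruence-continuity (`ltSMul_sub_ltSMul_mem`),
  and `[a]_f` maps division towers to division towers (`ltStepC_ltSMul_succ`);
* §2 `op_ltTorsionLift` — functoriality of Fontaine's element for a congruence-continuous operation `op` on `𝔫_𝒪`
  commuting with `P` (the unary form of the tree's `flim_op`);
* §3 ★ **`ltSMul_ltTorsionLift : [a]_f(x_t) = x_{[a]t}`** and **`gal_ltTorsionLift_of_galSeq_eq : σ x_t = [a]_f(x_t)`**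
  whenever `σ tₙ = [a]_f(tₙ)` for all `n` (e.g. `a = χ_π(σ)` for the `π`-power torsion tower of `F_f`) — the
  `𝒪_D`-linearity of `t ↦ x_t` behind the Galois law `σ(t_LT) = χ_π(σ)·t_LT` of the Lubin–Tate period (sequel).

No definitions, no named facts, no `sorry`.

## References
* J.-M. Fontaine, *Le corps des périodes p-adiques*, Astérisque 223 (1994), Exp. II §1.2. [FontaineAsterisque223III]
* P. Colmez, *Périodes des variétés abéliennes à multiplication complexe*, Ann. of Math. 138 (1993), §I.2. [Colmez1993]
* J. Lubin, J. Tate, *Formal complex multiplication in local fields*, Ann. of Math. 81 (1965), §1. [LubinTate1965]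
* J. W. S. Cassels, A. Fröhlich (eds.), *Algebraic Number Theory* (1967), Ch. VI §3. [CasselsFrohlichANT1967]
-/

noncomputable section

open Ideal Filter Topology Field WittVector MvPowerSeries ValuativeRel

namespace Literature.NumberTheory.PAdicHodge

open Literature.NumberTheory.GaloisRepresentations
open Literature.NumberTheory.GaloisRepresentations.IsNonarchimedeanLocalField
open Literature.NumberTheory.GaloisRepresentations.LubinTate

/-! ## §0 `P = cX + X^q` is a Lubin–Tate series for `(c, q)` -/

section Series

variable {A : Type*} [CommRing A] (c : A) (q : ℕ)

/-- `P = cX + X^q` as a power series. [cite: CasselsFrohlichANT1967, Ch. VI §3.3 Example (a)] -/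
theorem ltSeries_eq : ltSeries c q = PowerSeries.C c * PowerSeries.X + PowerSeries.X ^ q := by
  rw [ltSeries_def, ltPoly', Polynomial.coe_add, Polynomial.coe_mul, Polynomial.coe_pow, Polynomial.coe_C,
    Polynomial.coe_X]

variable {q} in
/-- **`P = cX + X^q` is a Lubin–Tate series for `(c, q)`** when `q ≥ 2`. [cite: CasselsFrohlichANT1967, Ch. VI §3.3 Example (a)] -/
theorem isLTSeries_ltSeries (hq : 2 ≤ q) : IsLTSeries c q (ltSeries c q) := by
  rw [ltSeries_eq]; exact isLTSeries_C_mul_X_add_X_pow hq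

end Series

variable {F : Type} [Field F] [ValuativeRel F] [TopologicalSpace F] [IsNonarchimedeanLocalField F] [CharZero F]
  {p : ℕ} [Fact p.Prime] {hp : valuation F p < 1} {D : EisensteinRoot F p hp}

namespace AinfRamTop

variable [Fact (¬ IsUnit (p : integerC F))] [IsAdicComplete (Ideal.span {(p : integerC F)}) (integerC F)]
  {hθ : Function.Surjective (fontaineTheta (integerC F) p)} {c : EisensteinRoot.CoeffDisc D} {q : ℕ} {hq : q ≠ 0}
  (hA : IsLTRing c q) (hf : IsLTSeries c q (ltSeries c q))

/-! ## §1 `[a]_f` on `𝔫_𝒪` and on `𝔪_{ℂ_F}`: `[c] = P`, commutation with `P`, `θ_𝒪`, `σ` -/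

/-- **`[c]_f = P` on `𝔫_𝒪`** (Lubin–Tate's `[π]_f = f`). [cite: LubinTate1965, §1 Thm. 1 (11)] -/
theorem ltSMul_self_eq_ltStep (a : (nilTheta D hθ).toIdeal) : ltSMul (nilTheta D hθ) hA hf c a = ltStep c hq a := by
  unfold ltSMul ltStep evalPt₁
  exact evalPt_congr _ (hom_self_eq hA hf) _ _ _

omit [Fact (¬ IsUnit (p : integerC F))] [IsAdicComplete (Ideal.span {(p : integerC F)}) (integerC F)] in
/-- **`[c]_f = P` on `𝔪_{ℂ_F}`.** [cite: LubinTate1965, §1 Thm. 1 (11)] -/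
theorem ltSMulC_self_eq_ltStepC (s : (maxNilIdealC F).toIdeal) :
    ltSMul (maxNilIdealC F) hA hf c s = ltStepC (D := D) c hq s := by
  unfold ltSMul ltStepC evalPt₁
  exact evalPt_congr _ (hom_self_eq hA hf) _ _ _

/-- **`[a]_f ∘ P = P ∘ [a]_f` on `𝔫_𝒪`** (`[a][c] = [ac] = [ca] = [c][a]`). [cite: LubinTate1965, §1 Thm. 1 (9)] -/
theorem ltSMul_ltStep (a : EisensteinRoot.CoeffDisc D) (x : (nilTheta D hθ).toIdeal) :
    ltSMul (nilTheta D hθ) hA hf a (ltStep c hq x) = ltStep c hq (ltSMul (nilTheta D hθ) hA hf a x) := by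
  rw [← ltSMul_self_eq_ltStep hA hf, ← ltSMul_self_eq_ltStep hA hf, ← mul_ltSMul, ← mul_ltSMul, mul_comm]

omit [Fact (¬ IsUnit (p : integerC F))] [IsAdicComplete (Ideal.span {(p : integerC F)}) (integerC F)] in
/-- **`[a]_f ∘ P = P ∘ [a]_f` on `𝔪_{ℂ_F}`.** [cite: LubinTate1965, §1 Thm. 1 (9)] -/
theorem ltSMul_ltStepC (a : EisensteinRoot.CoeffDisc D) (s : (maxNilIdealC F).toIdeal) :
    ltSMul (maxNilIdealC F) hA hf a (ltStepC (D := D) c hq s) = ltStepC c hq (ltSMul (maxNilIdealC F) hA hf a s) := by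
  rw [← ltSMulC_self_eq_ltStepC hA hf, ← ltSMulC_self_eq_ltStepC hA hf, ← mul_ltSMul, ← mul_ltSMul, mul_comm]

omit [Fact (¬ IsUnit (p : integerC F))] [IsAdicComplete (Ideal.span {(p : integerC F)}) (integerC F)] in
/-- **`[a]_f` maps division towers of `P` to division towers**: `P([a] t_{n+1}) = [a] tₙ`.
[cite: CasselsFrohlichANT1967, Ch. VI §3.4] -/
theorem ltStepC_ltSMul_succ (a : EisensteinRoot.CoeffDisc D) {t : ℕ → (maxNilIdealC F).toIdeal}
    (htp : ∀ n, ltStepC (D := D) c hq (t (n + 1)) = t n) (n : ℕ) :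
    ltStepC (D := D) c hq (ltSMul (maxNilIdealC F) hA hf a (t (n + 1))) = ltSMul (maxNilIdealC F) hA hf a (t n) := by
  rw [← ltSMul_ltStepC hA hf, htp]

/-- **`θ_𝒪([a]_f x) = [a]_f(θ_𝒪 x)`.** [cite: CasselsFrohlichANT1967, Ch. VI §3.2] -/
theorem theta_ltSMul (a : EisensteinRoot.CoeffDisc D) (x : (nilTheta D hθ).toIdeal) :
    theta D (ltSMul (nilTheta D hθ) hA hf a x : AinfRamTop D) =
      (ltSMul (maxNilIdealC F) hA hf a ⟨theta D x, theta_mem_maxNilIdealC x.2⟩ : CBall F) := by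
  unfold ltSMul evalPt₁
  exact theta_evalPt (EisensteinRoot.theta_algebraMap_coeffDisc D) _ _ _ _ fun _ => rfl

/-- **`σ([a]_f x) = [a]_f(σ x)`** (`σ ∈ Γ_F` fixes the coefficients `𝒪_D ⊂ F`). [cite: FontaineAsterisque223III, Exp. II §1.2] -/
theorem gal_ltSMul (σ : absoluteGaloisGroup F) (a : EisensteinRoot.CoeffDisc D) (x : (nilTheta D hθ).toIdeal) :
    gal D σ (ltSMul (nilTheta D hθ) hA hf a x : AinfRamTop D) =
      (ltSMul (nilTheta D hθ) hA hf a ⟨gal D σ x, gal_mem_nilTheta σ x.2⟩ : AinfRamTop D) := by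
  unfold ltSMul evalPt₁
  exact gal_evalPt σ (EisensteinRoot.gal_algebraMap_coeffDisc D σ) _ _ _ _ fun _ => rfl

/-- **Congruence-continuity of `[a]_f`**: `x ≡ x' (mod (p,ω)^{k+1}) ⇒ [a]x ≡ [a]x'`. [cite: CasselsFrohlichANT1967, Ch. VI §3.2] -/
theorem ltSMul_sub_ltSMul_mem (a : EisensteinRoot.CoeffDisc D) (k : ℕ) (x x' : (nilTheta D hθ).toIdeal)
    (h : (x : AinfRamTop D) - x' ∈ (WithIdeal.i ^ (k + 1) : Ideal (AinfRamTop D))) :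
    (ltSMul (nilTheta D hθ) hA hf a x : AinfRamTop D) - ltSMul (nilTheta D hθ) hA hf a x' ∈
      (WithIdeal.i ^ (k + 1) : Ideal (AinfRamTop D)) := by
  unfold ltSMul evalPt₁
  exact evalPt_sub_evalPt_mem (isClosed_of_pow_le le_rfl) _ _ _ _ fun _ => h

/-! ## §2 Functoriality of Fontaine's element for congruence-continuous operations -/

variable (hpq : p ∣ q) {k : ℕ}
  (hck : algebraMap (EisensteinRoot.CoeffDisc D) (AinfRamTop D) c ^ k ∈ (WithIdeal.i : Ideal (AinfRamTop D)))

omit hA hf in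
/-- **Functoriality of `t ↦ x_t` for an operation `op` on `𝔫_𝒪`** that is congruence-continuous for `(p, ω)`, commutes with
`P`, and lifts `t ↦ t'` through `θ_𝒪`: `op(x_t) = x_{t'}` (unary form of the additivity of Fontaine's limit).
[cite: FontaineAsterisque223III, Exp. II §1.2.2] -/
theorem op_ltTorsionLift (op : (nilTheta D hθ).toIdeal → (nilTheta D hθ).toIdeal)
    (hcong : ∀ (k : ℕ) (a a' : (nilTheta D hθ).toIdeal),
      (a : AinfRamTop D) - a' ∈ (WithIdeal.i ^ (k + 1) : Ideal (AinfRamTop D)) →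
      (op a : AinfRamTop D) - op a' ∈ (WithIdeal.i ^ (k + 1) : Ideal (AinfRamTop D)))
    (hopP : ∀ a, op (ltStep c hq a) = ltStep c hq (op a))
    {t t' : ℕ → (maxNilIdealC F).toIdeal} (htp : ∀ n, ltStepC c hq (t (n + 1)) = t n)
    (htp' : ∀ n, ltStepC c hq (t' (n + 1)) = t' n)
    (hst : ∀ n, theta D (op (ltLift D hθ t (k * n)) : AinfRamTop D) = t' (k * n)) :
    (op ⟨ltTorsionLift c hq hpq hck hθ t htp, ltTorsionLift_mem_nilTheta hpq hck htp⟩ : AinfRamTop D) =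
      ltTorsionLift c hq hpq hck hθ t' htp' := by
  have hopΦ : ∀ a, op ((ltStep c hq)^[k] a) = (ltStep c hq)^[k] (op a) :=
    Function.Commute.iterate_right (show Function.Commute op (ltStep c hq) from hopP) k
  rw [ltTorsionLift_eq_flim hpq hck htp' hst]
  have h := flim_op (isContracting_ltStep_iterate (hθ := hθ) hpq hck) (op := fun a _ => op a)
    (fun k a a' _ _ ha _ => hcong k a a' ha) (fun a _ => (hopΦ a).symm)
    (u := fun n => ltLift D hθ t (k * n)) (u' := fun n => ltLift D hθ t (k * n)) (w := fun n => op (ltLift D hθ t (k * n)))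
    (fun _ => rfl) (ltStep_iterate_lift_sub_mem htp fun n => theta_ltLift t (k * n))
    (ltStep_iterate_lift_sub_mem htp fun n => theta_ltLift t (k * n)) (ltStep_iterate_lift_sub_mem htp' hst)
  rw [h]
  rfl

/-! ## §3 `[a]_f(x_t) = x_{[a]t}` and `σ x_t = [χ(σ)]_f(x_t)` -/

/-- ★ **`𝒪_D`-linearity of Fontaine's element: `[a]_f(x_t) = x_{[a]t}`**, where `([a]t)ₙ = [a]_f(tₙ)` is again a division
tower of `P = [c]_f`. [cite: Colmez1993, §I.2] [cite: FontaineAsterisque223III, Exp. II §1.2.2] -/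
theorem ltSMul_ltTorsionLift (a : EisensteinRoot.CoeffDisc D) {t : ℕ → (maxNilIdealC F).toIdeal}
    (htp : ∀ n, ltStepC c hq (t (n + 1)) = t n) :
    (ltSMul (nilTheta D hθ) hA hf a ⟨ltTorsionLift c hq hpq hck hθ t htp, ltTorsionLift_mem_nilTheta hpq hck htp⟩ :
        AinfRamTop D) =
      ltTorsionLift c hq hpq hck hθ (fun n => ltSMul (maxNilIdealC F) hA hf a (t n)) (ltStepC_ltSMul_succ hA hf a htp) :=
  op_ltTorsionLift hpq hck _ (ltSMul_sub_ltSMul_mem hA hf a) (ltSMul_ltStep hA hf a) htp _ fun n => by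
    rw [theta_ltSMul]
    congr 2
    exact Subtype.ext (theta_ltLift t (k * n))

/-- ★ **`σ x_t = [a]_f(x_t)` whenever `σ tₙ = [a]_f(tₙ)` for all `n`** (for the `π`-power torsion tower of `F_f` this is
`a = χ_π(σ)`, the Lubin–Tate character). [cite: Colmez1993, §I.2] [cite: FontaineAsterisque223III, Exp. II §1.2] -/
theorem gal_ltTorsionLift_of_galSeq_eq (σ : absoluteGaloisGroup F) (a : EisensteinRoot.CoeffDisc D)
    {t : ℕ → (maxNilIdealC F).toIdeal} (htp : ∀ n, ltStepC c hq (t (n + 1)) = t n)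
    (hσ : ∀ n, AinfTop.galSeq F σ t n = ltSMul (maxNilIdealC F) hA hf a (t n)) :
    gal D σ (ltTorsionLift c hq hpq hck hθ t htp) =
      (ltSMul (nilTheta D hθ) hA hf a ⟨ltTorsionLift c hq hpq hck hθ t htp, ltTorsionLift_mem_nilTheta hpq hck htp⟩ :
        AinfRamTop D) := by
  rw [gal_ltTorsionLift hpq hck σ htp, ltSMul_ltTorsionLift hA hf hpq hck a htp]
  have h : AinfTop.galSeq F σ t = fun n => ltSMul (maxNilIdealC F) hA hf a (t n) := funext hσ
  exact flim_congr _ _ _ fun n => sub_mem_ideal_of_theta_eq (by rw [theta_ltLift, theta_ltLift, h])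

end AinfRamTop

/-! ## §4 The case `c = ϖ_D`, `q = p^r` -/

namespace EisensteinRoot

variable (D)

/-- **`f = ϖ_D X + X^{p^r}` is a Lubin–Tate series over `CoeffDisc D` for `(ϖ_D, p^r)`**, `r ≥ 1`.
[cite: CasselsFrohlichANT1967, Ch. VI §3.3 Example (a)] -/
theorem isLTSeries_ltSeries_varpi {r : ℕ} (hr : 0 < r) :
    IsLTSeries (CoeffDisc.of D (AdjoinRoot.root D.poly)) (p ^ r) (ltSeries (CoeffDisc.of D (AdjoinRoot.root D.poly)) (p ^ r)) :=
  isLTSeries_ltSeries _ (le_trans (Fact.out : p.Prime).two_le (Nat.le_self_pow (Nat.pos_iff_ne_zero.1 hr) p))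

end EisensteinRoot

end Literature.NumberTheory.PAdicHodge

end
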